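import Summits.QuantumFields.BalabanUV.Beta.GAN24.FibreRateFeedFF
import Summits.QuantumFields.BalabanUV.Beta.GAN24.FibreRateTBlockSum

/-!
# `BalabanUV.Beta.GAN24.FibreRateLegsD3` — binder row G-an2-4 / (CONV-C), road P1-fibre, leaf **P1-L11** `FibreRate` (Part B): the fm and ff legs at `d = 3`
# in the LITERAL units `CombesThomas.sfStep/smStep`, with rate `(Lc⁻²)^j`, AS FUNCTIONS of the alias-sum data (T-sum rate; reading-side and source-side bounds and rates)

NOT IN PRINT; OUR PROOF ATTEMPT.  HONEST FRAMING (cell contract, verbatim): «discharging `BetaPertH` makes Bałaban's UV stability UNCONDITIONAL — a real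
constructive-QFT result; it is NOT the continuum limit and NOT the Clay problem.»  HONEST DEPENDENCY (verbatim): «continuum YM on T⁴ ⇐ BetaPertH ∧ nine spine
estimates (0/9 proved); BetaPertH ⇐ (D1) ∧ (D4) ∧ CAP+tail; G-an2-4 gates asym, D1 and NE2/3/4.»  [folklore] unit bookkeeping (`sfStep Lc j·smStep 3 Lc j =
N⁵/Lc⁵`, `sfStep Lc j² = N²/Lc²`, `N = Lc^{j+1}` — BY NAME, TRIGGER-P1 c2) on top of `FibreRateFeed.norm_scaled_fm_sub_le`, `FibreRateFeedFF.norm_scaled_feed_sub_le`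
and leaf-11's T-sum (`FibreRateTBlock.tTerm`, `FibreRateTBlockLabel.tNorm`, `FibreRateTBlockSum.tSum`); no cited fact, no wall binder, no `def`, no `def … : Prop`
hypothesis (all alias-sum data are ORDINARY HYPOTHESES — PART T (leaf-11-g7) and PART S (leaf-07-g6) supply them).  NOT summit progress: these are the `hfm`/`hff`
hypotheses of `FibreRateOfLegs.realRateK_of_leg_rates` as functions; nothing of (CONV-C)'s K-slot is discharged; 0 wall binders instantiated; NOT `BetaPertH`,
NOT continuum, NOT Clay.

## What is proved (`d = 3`, `Lc ≥ 1`, every `j`, real `q ∈ [−π, π]^4 ∖ {0}`)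
* `sfsm_mul_eq` (`sf_j sm_j·F = Lc^{−5}·(N^5·F)`), **`fm_rate_of_reading_data`**: `‖sf_{j+1}sm_{j+1}F_{j+1} − sf_j sm_j F_j‖ ≤ (4(Q_φ·cPP|q|² + A_φ·crPP|q|⁴) +
  Q_c·cPc|q|²√|q|² + A_c·crPc|q|⁴√|q|²)/Lc^7·(Lc⁻²)^j` for the fm readout `F = Σ_m readW·Â(0, e_l)`;
* `sum_tTerm_eq` (`Σ_m tTerm = tSum/N²` at `D = 4`), `sf_sq_mul_ff_eq` (`sf_j²·Σ_m readW·Â(f̂,0) = Lc⁻²·(tSum_j + N⁻³N⁵·feed_j)`),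
  **`ff_rate_of_data`**: `‖sf_{j+1}²FF_{j+1} − sf_j²FF_j‖ ≤ (T + 4(Q_φ·BΦ + A_φ·KΦ) + Q_c·BC + A_c·KC)/Lc⁴·(Lc⁻²)^j` from the T-sum rate `T/N²` and both sides' data.

Unit `b2b-balaban-gan24-formalise-leaf-20` (G-an2-4 formalisation swarm, leaf prover 20), 2026-08-20.  Value = kernel assembly leaf toward the K-slot route P1,
NOT summit progress.
-/

noncomputable section

open Complex Finset
open scoped BigOperators Real

namespace Summit.QuantumFields.BalabanUV.Beta.GAN24.FibreRateLegsD3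

open Literature.MathematicalPhysics.QuantumFieldTheory.Balaban1983to89.B4Strip (ofRealVec)
open Literature.MathematicalPhysics.QuantumFieldTheory.King1986 (momSq momSq_nonneg)

/-! ## The fm and ff legs at `d = 3` in the literal units, as functions of the alias-sum data -/

section D3
open Literature.Probability.LatticeModels (TorusSite)
open AliasObjects (cap phiSol cSol srcPhi srcC readW Ahat fhatF eVec)
open FibreRateFeedTerms (rPhiTerm rCTerm)
open FibreRateTBlock (tTerm)
open FibreRateTBlockLabel (tNorm)
open FibreRateTBlockSum (tSum)
open CombesThomas (sfStep smStep)
open CapacitanceEndpointBlocks (cPP cPc ccc)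
open CapacitanceRateScaled (crPP crPc crcc)
open FibreRateMF (smStep_mul_sfStep_three)
open FibreRateFeed (sum_readW_Ahat_fhatF norm_scaled_fm_sub_le)
open FibreRateFeedFF (norm_scaled_feed_sub_le)

variable {Lc : ℕ} [NeZero Lc]

/-- [folklore] The scaled fm readout in the literal units: `sf_j·sm_j·F = Lc^{−5}·(N^5·F)`, `N = Lc^{j+1}` (`sfStep·smStep = N⁵/Lc⁵` at `d = 3`). -/
theorem sfsm_mul_eq (j : ℕ) (F : ℂ) :
    ((sfStep Lc j * smStep 3 Lc j : ℝ) : ℂ) * F = ((Lc : ℂ) ^ 5)⁻¹ * ((((Lc ^ (j + 1) : ℕ) : ℂ) ^ (3 + 1 + 1)) * F) := by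
  have hLc : (Lc : ℝ) ≠ 0 := Nat.cast_ne_zero.2 (NeZero.ne Lc)
  have hLcC : (Lc : ℂ) ^ 5 ≠ 0 := pow_ne_zero _ (Nat.cast_ne_zero.2 (NeZero.ne Lc))
  rw [mul_comm (sfStep Lc j), smStep_mul_sfStep_three hLc]
  push_cast
  field_simp

/-- **ROW L11, fm LEG AS A FUNCTION OF THE READING-SIDE DATA** [folklore] (`d = 3`, literal units `sfStep·smStep`, rate `(Lc⁻²)^j`):
with reading-side bounds `A_φ, A_c` (level `N = Lc^{j+1}`) and rates `Q_φ/N², Q_c/N²` (between `N` and `N′ = Lc^{j+2}`) at the leg `(κ, x′)`,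
`‖sf_{j+1}sm_{j+1}·F_{j+1} − sf_j sm_j·F_j‖ ≤ (4(Q_φ·cPP|q|² + A_φ·crPP|q|⁴) + Q_c·cPc|q|²√|q|² + A_c·crPc|q|⁴√|q|²)/Lc^7 · (Lc⁻²)^j`. -/
theorem fm_rate_of_reading_data (j : ℕ) {q : Fin (3 + 1) → ℝ} (hq : ∀ i, |q i| ≤ π) (hq0 : q ≠ 0) (κ l : Fin (3 + 1)) (x' : Fin (3 + 1) → ℤ)
    {Aφ Ac Qφ Qc : ℝ}
    (hAφ : ∀ l', ‖((((Lc ^ (j + 1) : ℕ) : ℂ) ^ 3)⁻¹) * ∑ m, rPhiTerm (Lc ^ (j + 1)) (Lc ^ j) (ofRealVec q) m κ l' x'‖ ≤ Aφ)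
    (hAc : ‖((((Lc ^ (j + 1) : ℕ) : ℂ) ^ 3)⁻¹) * ∑ m, rCTerm (Lc ^ (j + 1)) (Lc ^ j) (ofRealVec q) m κ x'‖ ≤ Ac)
    (hQφ : ∀ l', ‖((((Lc ^ (j + 2) : ℕ) : ℂ) ^ 3)⁻¹) * ∑ m, rPhiTerm (Lc ^ (j + 2)) (Lc ^ (j + 1)) (ofRealVec q) m κ l' x'
        - ((((Lc ^ (j + 1) : ℕ) : ℂ) ^ 3)⁻¹) * ∑ m, rPhiTerm (Lc ^ (j + 1)) (Lc ^ j) (ofRealVec q) m κ l' x'‖ ≤ Qφ / (((Lc ^ (j + 1) : ℕ) : ℝ)) ^ 2)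
    (hQc : ‖((((Lc ^ (j + 2) : ℕ) : ℂ) ^ 3)⁻¹) * ∑ m, rCTerm (Lc ^ (j + 2)) (Lc ^ (j + 1)) (ofRealVec q) m κ x'
        - ((((Lc ^ (j + 1) : ℕ) : ℂ) ^ 3)⁻¹) * ∑ m, rCTerm (Lc ^ (j + 1)) (Lc ^ j) (ofRealVec q) m κ x'‖ ≤ Qc / (((Lc ^ (j + 1) : ℕ) : ℝ)) ^ 2) :
    ‖((sfStep Lc (j + 1) * smStep 3 Lc (j + 1) : ℝ) : ℂ) * ∑ m', readW (Lc ^ (j + 2)) (Lc ^ (j + 1)) (ofRealVec q) m' κ x' *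
          Ahat (Lc ^ (j + 2)) (ofRealVec q) 0 (eVec l) m' κ
        - ((sfStep Lc j * smStep 3 Lc j : ℝ) : ℂ) * ∑ m, readW (Lc ^ (j + 1)) (Lc ^ j) (ofRealVec q) m κ x' *
          Ahat (Lc ^ (j + 1)) (ofRealVec q) 0 (eVec l) m κ‖
      ≤ ((3 + 1 : ℕ) * (Qφ * (cPP (3 + 1) * momSq q) + Aφ * (crPP (3 + 1) * momSq q ^ 2))
          + Qc * (cPc (3 + 1) * (momSq q * Real.sqrt (momSq q))) + Ac * (crPc (3 + 1) * (momSq q ^ 2 * Real.sqrt (momSq q)))) / (Lc : ℝ) ^ 7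
        * (((Lc : ℝ) ^ 2)⁻¹) ^ j := by
  have hLc1 : 1 ≤ Lc := Nat.one_le_iff_ne_zero.2 (NeZero.ne Lc)
  have hLc0 : (0 : ℝ) < Lc := by exact_mod_cast hLc1
  have hN : 1 ≤ Lc ^ (j + 1) := Nat.one_le_pow _ _ hLc1
  have hNN' : Lc ^ (j + 1) ≤ Lc ^ (j + 2) := Nat.pow_le_pow_right hLc1 (by omega)
  have h := norm_scaled_fm_sub_le (D := 3 + 1) hN hNN' hq hq0 (Lc ^ j) (Lc ^ (j + 1)) κ l x' hAφ hAc hQφ hQc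
  rw [sfsm_mul_eq (j + 1), sfsm_mul_eq j, ← mul_sub, norm_mul, norm_inv, norm_pow, Complex.norm_natCast]
  set K := (3 + 1 : ℕ) * (Qφ * (cPP (3 + 1) * momSq q) + Aφ * (crPP (3 + 1) * momSq q ^ 2))
          + Qc * (cPc (3 + 1) * (momSq q * Real.sqrt (momSq q))) + Ac * (crPc (3 + 1) * (momSq q ^ 2 * Real.sqrt (momSq q))) with hK
  have e : ((Lc : ℝ) ^ 5)⁻¹ * (K / (((Lc ^ (j + 1) : ℕ) : ℝ)) ^ 2) = K / (Lc : ℝ) ^ 7 * (((Lc : ℝ) ^ 2)⁻¹) ^ j := by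
    have hL2 : (((Lc : ℝ) ^ 2)⁻¹) ^ j = ((Lc : ℝ) ^ (2 * j))⁻¹ := by rw [inv_pow, ← pow_mul]
    push_cast
    rw [hL2]
    field_simp
    ring
  rw [← e]
  refine mul_le_mul_of_nonneg_left ?_ (inv_nonneg.2 (pow_nonneg hLc0.le 5))
  convert h using 2

/-- [folklore] `Σ_m tTerm = tSum / N²` at `D = 4` (leaf-11's `tNorm = N^D·tTerm/N²`, `tSum = Σ_m tNorm`). -/
theorem sum_tTerm_eq {N : ℕ} [NeZero N] (M : ℕ) (q : Fin (3 + 1) → ℝ) (κ l : Fin (3 + 1)) (x' y' : Fin (3 + 1) → ℤ) :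
    ∑ m, tTerm N M (ofRealVec q) m κ l x' y' = tSum N M q κ l x' y' / (N : ℂ) ^ 2 := by
  have hN : (N : ℂ) ≠ 0 := by exact_mod_cast NeZero.ne N
  unfold FibreRateTBlockSum.tSum FibreRateTBlockLabel.tNorm
  rw [Finset.sum_div]
  refine Finset.sum_congr rfl fun m _ => ?_
  field_simp

/-- [folklore] **THE ff READOUT IN THE LITERAL UNITS, SPLIT**: `sf_j²·Σ_m readW·Â(f̂, 0) = Lc⁻²·(tSum_j + N⁻³N⁵·feed_j)` at `d = 3`, `N = Lc^{j+1}`, `M = Lc^j`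
(`sfStep Lc j² = N²/Lc²`; leaf-11's `ff_summand_split` through `FibreRateFeed.sum_readW_Ahat_fhatF`). -/
theorem sf_sq_mul_ff_eq (j : ℕ) (q : Fin (3 + 1) → ℝ) (κ l : Fin (3 + 1)) (x' y' : Fin (3 + 1) → ℤ) :
    ((sfStep Lc j * sfStep Lc j : ℝ) : ℂ) * ∑ m, readW (Lc ^ (j + 1)) (Lc ^ j) (ofRealVec q) m κ x' *
        Ahat (Lc ^ (j + 1)) (ofRealVec q) (fhatF (Lc ^ (j + 1)) (Lc ^ j) (ofRealVec q) l y') 0 m κ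
      = ((Lc : ℂ) ^ 2)⁻¹ * (tSum (Lc ^ (j + 1)) (Lc ^ j) q κ l x' y'
          + ((((Lc ^ (j + 1) : ℕ) : ℂ) ^ 3)⁻¹) * ((((Lc ^ (j + 1) : ℕ) : ℂ) ^ (3 + 1 + 1)) *
            (∑ l', (∑ m, rPhiTerm (Lc ^ (j + 1)) (Lc ^ j) (ofRealVec q) m κ l' x') *
                phiSol (Lc ^ (j + 1)) (ofRealVec q) (fhatF (Lc ^ (j + 1)) (Lc ^ j) (ofRealVec q) l y') 0 l'
              + (∑ m, rCTerm (Lc ^ (j + 1)) (Lc ^ j) (ofRealVec q) m κ x') *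
                cSol (Lc ^ (j + 1)) (ofRealVec q) (fhatF (Lc ^ (j + 1)) (Lc ^ j) (ofRealVec q) l y') 0))) := by
  have hLcC : (Lc : ℂ) ≠ 0 := Nat.cast_ne_zero.2 (NeZero.ne Lc)
  have hN : (((Lc ^ (j + 1) : ℕ) : ℂ)) ≠ 0 := by exact_mod_cast pow_ne_zero _ (NeZero.ne Lc)
  rw [sum_readW_Ahat_fhatF, sum_tTerm_eq]
  have hsf : ((sfStep Lc j * sfStep Lc j : ℝ) : ℂ) = (((Lc ^ (j + 1) : ℕ) : ℂ)) ^ 2 / (Lc : ℂ) ^ 2 := by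
    unfold CombesThomas.sfStep
    push_cast
    field_simp
    ring
  rw [hsf]
  field_simp
  ring

/-- **ROW L11, ff LEG AS A FUNCTION OF THE ALIAS-SUM DATA** [folklore] (`d = 3`, literal unit `sfStep²`, rate `(Lc⁻²)^j`): with the T-sum rate
`‖tSum_{j+1} − tSum_j‖ ≤ T/N²` (leaf-11), reading-side data `(A_φ, A_c; Q_φ, Q_c)` at `(κ, x′)` and source-side data `(B_φ, B_c; R_φ, R_c)` for the force
`(l, y′)` (leaf-07), `‖sf_{j+1}²·FF_{j+1} − sf_j²·FF_j‖ ≤ (T + D(Q_φ·BΦ + A_φ·KΦ) + Q_c·BC + A_c·KC)/Lc⁴ · (Lc⁻²)^j` (`BΦ, BC, KΦ, KC` as in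
`FibreRateFeedFF.norm_scaled_feed_sub_le`, `N = Lc^{j+1}`). -/
theorem ff_rate_of_data (j : ℕ) {q : Fin (3 + 1) → ℝ} (hq : ∀ i, |q i| ≤ π) (hq0 : q ≠ 0) (κ l : Fin (3 + 1)) (x' y' : Fin (3 + 1) → ℤ)
    {T Aφ Ac Qφ Qc Bφ Bc Rφ Rc : ℝ}
    (hT : ‖tSum (Lc ^ (j + 2)) (Lc ^ (j + 1)) q κ l x' y' - tSum (Lc ^ (j + 1)) (Lc ^ j) q κ l x' y'‖ ≤ T / (((Lc ^ (j + 1) : ℕ) : ℝ)) ^ 2)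
    (hAφ : ∀ l', ‖((((Lc ^ (j + 1) : ℕ) : ℂ) ^ 3)⁻¹) * ∑ m, rPhiTerm (Lc ^ (j + 1)) (Lc ^ j) (ofRealVec q) m κ l' x'‖ ≤ Aφ)
    (hAc : ‖((((Lc ^ (j + 1) : ℕ) : ℂ) ^ 3)⁻¹) * ∑ m, rCTerm (Lc ^ (j + 1)) (Lc ^ j) (ofRealVec q) m κ x'‖ ≤ Ac)
    (hQφ : ∀ l', ‖((((Lc ^ (j + 2) : ℕ) : ℂ) ^ 3)⁻¹) * ∑ m, rPhiTerm (Lc ^ (j + 2)) (Lc ^ (j + 1)) (ofRealVec q) m κ l' x'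
        - ((((Lc ^ (j + 1) : ℕ) : ℂ) ^ 3)⁻¹) * ∑ m, rPhiTerm (Lc ^ (j + 1)) (Lc ^ j) (ofRealVec q) m κ l' x'‖ ≤ Qφ / (((Lc ^ (j + 1) : ℕ) : ℝ)) ^ 2)
    (hQc : ‖((((Lc ^ (j + 2) : ℕ) : ℂ) ^ 3)⁻¹) * ∑ m, rCTerm (Lc ^ (j + 2)) (Lc ^ (j + 1)) (ofRealVec q) m κ x'
        - ((((Lc ^ (j + 1) : ℕ) : ℂ) ^ 3)⁻¹) * ∑ m, rCTerm (Lc ^ (j + 1)) (Lc ^ j) (ofRealVec q) m κ x'‖ ≤ Qc / (((Lc ^ (j + 1) : ℕ) : ℝ)) ^ 2)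
    (hBφ : ∀ l', ‖((((Lc ^ (j + 2) : ℕ) : ℂ) ^ 3)⁻¹) *
        srcPhi (Lc ^ (j + 2)) (ofRealVec q) (fhatF (Lc ^ (j + 2)) (Lc ^ (j + 1)) (ofRealVec q) l y') 0 l'‖ ≤ Bφ)
    (hBc : ‖((((Lc ^ (j + 2) : ℕ) : ℂ) ^ 3)⁻¹) * srcC (Lc ^ (j + 2)) (ofRealVec q) (fhatF (Lc ^ (j + 2)) (Lc ^ (j + 1)) (ofRealVec q) l y')‖ ≤ Bc)
    (hRφ : ∀ l', ‖((((Lc ^ (j + 2) : ℕ) : ℂ) ^ 3)⁻¹) * srcPhi (Lc ^ (j + 2)) (ofRealVec q) (fhatF (Lc ^ (j + 2)) (Lc ^ (j + 1)) (ofRealVec q) l y') 0 l'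
        - ((((Lc ^ (j + 1) : ℕ) : ℂ) ^ 3)⁻¹) * srcPhi (Lc ^ (j + 1)) (ofRealVec q) (fhatF (Lc ^ (j + 1)) (Lc ^ j) (ofRealVec q) l y') 0 l'‖
        ≤ Rφ / (((Lc ^ (j + 1) : ℕ) : ℝ)) ^ 2)
    (hRc : ‖((((Lc ^ (j + 2) : ℕ) : ℂ) ^ 3)⁻¹) * srcC (Lc ^ (j + 2)) (ofRealVec q) (fhatF (Lc ^ (j + 2)) (Lc ^ (j + 1)) (ofRealVec q) l y')
        - ((((Lc ^ (j + 1) : ℕ) : ℂ) ^ 3)⁻¹) * srcC (Lc ^ (j + 1)) (ofRealVec q) (fhatF (Lc ^ (j + 1)) (Lc ^ j) (ofRealVec q) l y')‖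
        ≤ Rc / (((Lc ^ (j + 1) : ℕ) : ℝ)) ^ 2) :
    ‖((sfStep Lc (j + 1) * sfStep Lc (j + 1) : ℝ) : ℂ) * ∑ m', readW (Lc ^ (j + 2)) (Lc ^ (j + 1)) (ofRealVec q) m' κ x' *
          Ahat (Lc ^ (j + 2)) (ofRealVec q) (fhatF (Lc ^ (j + 2)) (Lc ^ (j + 1)) (ofRealVec q) l y') 0 m' κ
        - ((sfStep Lc j * sfStep Lc j : ℝ) : ℂ) * ∑ m, readW (Lc ^ (j + 1)) (Lc ^ j) (ofRealVec q) m κ x' *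
          Ahat (Lc ^ (j + 1)) (ofRealVec q) (fhatF (Lc ^ (j + 1)) (Lc ^ j) (ofRealVec q) l y') 0 m κ‖
      ≤ (T + ((3 + 1 : ℕ) * (Qφ * ((3 + 1 : ℕ) * (cPP (3 + 1) * momSq q * Bφ) + cPc (3 + 1) * (momSq q * Real.sqrt (momSq q)) * Bc)
              + Aφ * ((3 + 1 : ℕ) * (crPP (3 + 1) * momSq q ^ 2 * Bφ + cPP (3 + 1) * momSq q * Rφ)
                + crPc (3 + 1) * (momSq q ^ 2 * Real.sqrt (momSq q)) * Bc + cPc (3 + 1) * (momSq q * Real.sqrt (momSq q)) * Rc))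
          + Qc * ((3 + 1 : ℕ) * (cPc (3 + 1) * (momSq q * Real.sqrt (momSq q)) * Bφ) + ccc (3 + 1) * momSq q ^ 2 * Bc)
          + Ac * ((3 + 1 : ℕ) * (crPc (3 + 1) * (momSq q ^ 2 * Real.sqrt (momSq q)) * Bφ + cPc (3 + 1) * (momSq q * Real.sqrt (momSq q)) * Rφ)
                + crcc (3 + 1) * momSq q ^ 3 * Bc + ccc (3 + 1) * momSq q ^ 2 * Rc))) / (Lc : ℝ) ^ 4
        * (((Lc : ℝ) ^ 2)⁻¹) ^ j := by
  have hLc1 : 1 ≤ Lc := Nat.one_le_iff_ne_zero.2 (NeZero.ne Lc)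
  have hLc0 : (0 : ℝ) < Lc := by exact_mod_cast hLc1
  have hN : 1 ≤ Lc ^ (j + 1) := Nat.one_le_pow _ _ hLc1
  have hNN' : Lc ^ (j + 1) ≤ Lc ^ (j + 2) := Nat.pow_le_pow_right hLc1 (by omega)
  have hfeed := norm_scaled_feed_sub_le (D := 3 + 1) hN hNN' hq hq0 (Lc ^ j) (Lc ^ (j + 1)) κ x' hAφ hAc hQφ hQc hBφ hBc hRφ hRc
  rw [sf_sq_mul_ff_eq (j + 1), sf_sq_mul_ff_eq j, ← mul_sub, norm_mul, norm_inv, norm_pow, Complex.norm_natCast,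
    show ∀ (a b c e : ℂ), (a + b) - (c + e) = (a - c) + (b - e) from fun _ _ _ _ => by ring]
  have hsum := (norm_add_le _ _).trans (add_le_add hT hfeed)
  rw [← add_div] at hsum
  set K := T + ((3 + 1 : ℕ) * (Qφ * ((3 + 1 : ℕ) * (cPP (3 + 1) * momSq q * Bφ) + cPc (3 + 1) * (momSq q * Real.sqrt (momSq q)) * Bc)
              + Aφ * ((3 + 1 : ℕ) * (crPP (3 + 1) * momSq q ^ 2 * Bφ + cPP (3 + 1) * momSq q * Rφ)
                + crPc (3 + 1) * (momSq q ^ 2 * Real.sqrt (momSq q)) * Bc + cPc (3 + 1) * (momSq q * Real.sqrt (momSq q)) * Rc))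
          + Qc * ((3 + 1 : ℕ) * (cPc (3 + 1) * (momSq q * Real.sqrt (momSq q)) * Bφ) + ccc (3 + 1) * momSq q ^ 2 * Bc)
          + Ac * ((3 + 1 : ℕ) * (crPc (3 + 1) * (momSq q ^ 2 * Real.sqrt (momSq q)) * Bφ + cPc (3 + 1) * (momSq q * Real.sqrt (momSq q)) * Rφ)
                + crcc (3 + 1) * momSq q ^ 3 * Bc + ccc (3 + 1) * momSq q ^ 2 * Rc)) with hK
  have e : ((Lc : ℝ) ^ 2)⁻¹ * (K / (((Lc ^ (j + 1) : ℕ) : ℝ)) ^ 2) = K / (Lc : ℝ) ^ 4 * (((Lc : ℝ) ^ 2)⁻¹) ^ j := by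
    have hL2 : (((Lc : ℝ) ^ 2)⁻¹) ^ j = ((Lc : ℝ) ^ (2 * j))⁻¹ := by rw [inv_pow, ← pow_mul]
    push_cast
    rw [hL2]
    field_simp
    ring
  rw [← e]
  refine mul_le_mul_of_nonneg_left ?_ (inv_nonneg.2 (pow_nonneg hLc0.le 2))
  convert hsum using 2

end D3

end Summit.QuantumFields.BalabanUV.Beta.GAN24.FibreRateLegsD3

end
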